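import Literature.NumberTheory.LFunctions.ExplicitFormulaPsiCharLogDeriv
import Literature.NumberTheory.LFunctions.FordZetaLogDerivLeftLine
import Literature.NumberTheory.LFunctions.KhaleLemma41
import HarnessLib

/-!
# Khale 2024, Lemma 4.2: `|L'/L(−½ + iu, χ)| ≤ 8.21 + log q + ½ log(1 + u²/4)` for primitive `χ`

Topic `Literature/NumberTheory/LFunctions`.  Everything in this file is PROVED; no definition, no
named fact.  **Lemma 4.2 of T. Khale, *An explicit Vinogradov–Korobov zero-free region for
Dirichlet L-functions*, Q. J. Math. 75 (2024) = arXiv:2210.06457v1 (pp. 6–7)**: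

> Let `χ` (mod `q`) be a primitive Dirichlet character, with `q ≥ 3`, and let `u` be real. Then
> `|L'/L(−1/2 + iu, χ)| ≤ 8.21 + log q + ½ log(1 + u²/4)`.

It bounds the integrand on the line `Re w = −1/2` to which the contour is moved in Lemma 6.5 of
the source (the smoothed explicit formula for `K_χ(s) = Σ Λ(n)χ(n)n^{−s} f(log n)`), exactly as
Ford's Lemma 3.2 (`FordL32.norm_logDeriv_zeta_left_le`, `FordZetaLogDerivLeftLine.lean`) does for
`ζ`; it is one of the "basic estimates" (§4) under the bootstrapping Theorem 3.1, the analytic core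
of the named fact `Literature.NumberTheory.LFunctions.Khale2024_zeroFreeRegion`
(`VinogradovKorobovDirichletProofs.lean`).

## Proof (the printed one, with the digamma term kept as a real part)

The functional equation in logarithmic-derivative form (the tree's
`ExplicitPsiChar.logDeriv_LFunction_eq_reflect`, Montgomery–Vaughan Lemma 12.8) gives, for
`s = −1/2 + iu` and `a ∈ {0, 1}` the parity of `χ`,

  `−L'/L(s, χ) = L'/L(1 − s, χ̄) + log(q/π) + ½(ψ((s+a)/2) + ψ((1−s+a)/2))`

(the source's rearranged display, p. 6), and with `z = ¾ + a/2 + iu/2`, `ψ(w + 1) = ψ(w) + 1/w`,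
`ψ(z̄) = conj ψ(z)`: `½(ψ((s+a)/2) + ψ((1−s+a)/2)) = Re ψ(z) + 1/(½ − a − iu)` — the source's (4.1)
(`KhaleL42.logDeriv_LFunction_left_eq`).  Hence
`|L'/L(s, χ)| ≤ |log(q/π)| + |L'/L(3/2 − iu, χ̄)| + |Re ψ(z)| + 2`, where `|log(q/π)| ≤ log q − 1`
(`q ≥ 3`), `|L'/L(3/2 − iu, χ̄)| ≤ −ζ'/ζ(3/2)` — the source uses the value `1.505236`; the tree's
`KhaleL41.norm_logDeriv_LFunction_lt` gives `< 2`, which suffices with room — and, in place of the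
Ono–Soundararajan bound `|ψ(z)| ≤ 11/3 + ½log(1+x²) + ½log(1+y²)` quoted by the source, the sharper
in-tree facts about `Re ψ` only: the series `Re ψ(x+iy) + γ = Σ[1/(k+1) − (x+k)/((x+k)²+y²)]`
(`FordL32.hasSum_re_digamma`), its monotonicity in `|y|` (`FordL32.re_digamma_mono`),
`Re ψ(¾) > −4/3` (`FordL32.re_digamma_three_quarters_ge`) and the Stirling-type bound
`Re ψ(w) ≤ log‖w‖ + 1/(2‖w‖²) + π/(4|Im w|)` (`re_digamma_le_log_norm_add`), giving
`−4/3 ≤ Re ψ(x + iy) ≤ 1.9 + ½ log(1 + y²)` for `x ∈ [¾, 5/4]` (`KhaleL42.re_digamma_lower`,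
`KhaleL42.re_digamma_upper`).  Altogether `|L'/L(−½+iu, χ)| ≤ log q + 4.9 + ½ log(1 + u²/4)`
(`KhaleL42.norm_logDeriv_LFunction_left_le_sharp`), which implies the printed `8.21`.

## Main statements

* `KhaleL42.LFunction_left_ne_zero` — `L(−½ + iu, χ) ≠ 0` (primitive `χ`, `q ≥ 2`).
* `KhaleL42.logDeriv_LFunction_left_eq` — the identity (4.1)/(4.2) of the source.
* `KhaleL42.norm_logDeriv_LFunction_left_le` — **Lemma 4.2** as printed.

## References

* T. Khale, arXiv:2210.06457v1, Lemma 4.2 and its proof, (4.1)–(4.2) (pp. 6–7). [Khale2024]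
* K. Ono, K. Soundararajan, *Ramanujan's ternary quadratic form*, Invent. Math. 130 (1997), Lemma 4
  (the digamma bound quoted by the source; not used here). [cited through Khale2024]
* H. L. Montgomery, R. C. Vaughan, *Multiplicative Number Theory I*, CUP 2007, Lemma 12.8.
  [MontgomeryVaughan2007]
-/

noncomputable section

open Complex Filter Topology Set
open scoped Real ComplexConjugate

namespace Literature.NumberTheory.LFunctions

namespace KhaleL42

open DirichletCharacter ExplicitPsiChar Literature.Analysis.SpecialFunctions.Complex

/-! ### Bounds for `Re ψ(x + iy)`, `x ∈ [3/4, 5/4]` -/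

/-- `Re ψ(x) ≥ Re ψ(3/4)` for `x ≥ 3/4` (the series `ψ(x) + γ = Σ [1/(k+1) − 1/(x+k)]` is
termwise increasing in `x`). [folklore] -/
theorem re_digamma_three_quarters_le_re_digamma {x : ℝ} (hx : 3 / 4 ≤ x) :
    (digamma (((3 / 4 : ℝ) : ℂ) + ((0 : ℝ) : ℂ) * I)).re ≤ (digamma ((x : ℂ) + ((0 : ℝ) : ℂ) * I)).re := by
  have h1 := FordL32.hasSum_re_digamma (by norm_num : (0 : ℝ) < 3 / 4) 0
  have h2 := FordL32.hasSum_re_digamma (by linarith : (0 : ℝ) < x) 0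
  have := hasSum_le (fun k ↦ ?_) h1 h2
  · linarith
  have hk : (0 : ℝ) ≤ k := Nat.cast_nonneg k
  have ha : (0 : ℝ) < 3 / 4 + k := by positivity
  have hb : (0 : ℝ) < x + k := by linarith
  have ea : (3 / 4 + (k : ℝ)) / ((3 / 4 + k) ^ 2 + (0 : ℝ) ^ 2) = 1 / (3 / 4 + k) := by
    rw [zero_pow two_ne_zero, add_zero, sq, ← div_div, div_self ha.ne']
  have eb : (x + (k : ℝ)) / ((x + k) ^ 2 + (0 : ℝ) ^ 2) = 1 / (x + k) := by
    rw [zero_pow two_ne_zero, add_zero, sq, ← div_div, div_self hb.ne']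
  rw [ea, eb]
  have : 1 / (x + (k : ℝ)) ≤ 1 / (3 / 4 + k) := one_div_le_one_div_of_le ha (by linarith)
  linarith

/-- **Lower bound**: `Re ψ(x + iy) ≥ −4/3` for `x ≥ 3/4` (monotone in `|y|`, then in `x`, then
`Re ψ(3/4) > −4/3`). [folklore] -/
theorem re_digamma_lower {x : ℝ} (hx : 3 / 4 ≤ x) (y : ℝ) :
    -(4 / 3 : ℝ) ≤ (digamma ((x : ℂ) + (y : ℂ) * I)).re := by
  have h0 : (digamma ((x : ℂ) + ((0 : ℝ) : ℂ) * I)).re ≤ (digamma ((x : ℂ) + (y : ℂ) * I)).re :=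
    FordL32.re_digamma_mono (by linarith) (by simp)
  linarith [FordL32.re_digamma_three_quarters_ge, re_digamma_three_quarters_le_re_digamma hx]

/-- The Stirling-type upper bound made numerical: for `3/4 ≤ x ≤ 5/4` and `|y| ≥ 1`,
`Re ψ(x + iy) ≤ 1.39 + ½ log(1 + y²)` (`log‖w‖ ≤ ½ log(25/16) + ½ log(1+y²)`,
`1/(2‖w‖²) ≤ 0.32`, `π/(4|y|) ≤ π/4`). [folklore] -/
theorem re_digamma_upper_of_one_le {x y : ℝ} (hx : 3 / 4 ≤ x) (hx' : x ≤ 5 / 4) (hy : 1 ≤ |y|) :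
    (digamma ((x : ℂ) + (y : ℂ) * I)).re ≤ 1.39 + 1 / 2 * Real.log (1 + y ^ 2) := by
  set w : ℂ := (x : ℂ) + (y : ℂ) * I with hw
  have hwre : w.re = x := by simp [hw]
  have hwim : w.im = y := by simp [hw]
  have hy0 : y ≠ 0 := fun h ↦ by rw [h, abs_zero] at hy; linarith
  have h := re_digamma_le_log_norm_add (w := w) (by rw [hwre]; linarith) (by rwa [hwim])
  have hnsq : ‖w‖ ^ 2 = x ^ 2 + y ^ 2 := by
    rw [Complex.sq_norm, Complex.normSq_apply, hwre, hwim]; ring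
  have hy2 : 1 ≤ y ^ 2 := by nlinarith [abs_nonneg y, sq_abs y]
  -- `log ‖w‖ = ½ log(x² + y²) ≤ ½ (log(25/16) + log(1 + y²))`, `log(25/16) ≤ 9/16`
  have hlog : Real.log ‖w‖ ≤ 1 / 2 * (9 / 16) + 1 / 2 * Real.log (1 + y ^ 2) := by
    have e : Real.log ‖w‖ = 1 / 2 * Real.log (x ^ 2 + y ^ 2) := by
      rw [← hnsq, Real.log_pow]; ring
    rw [e, ← mul_add]
    refine mul_le_mul_of_nonneg_left ?_ (by norm_num)
    have h1 : x ^ 2 + y ^ 2 ≤ 25 / 16 * (1 + y ^ 2) := by nlinarith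
    have h2 : Real.log (x ^ 2 + y ^ 2) ≤ Real.log (25 / 16 * (1 + y ^ 2)) :=
      Real.log_le_log (by positivity) h1
    rw [Real.log_mul (by norm_num) (by positivity)] at h2
    have h3 : Real.log (25 / 16 : ℝ) ≤ 25 / 16 - 1 := Real.log_le_sub_one_of_pos (by norm_num)
    linarith
  have hinv : 1 / (2 * ‖w‖ ^ 2) ≤ 0.32 := by
    rw [hnsq, div_le_iff₀ (by positivity)]; nlinarith
  have hpi : π / (4 * |w.im|) ≤ 0.7875 := by
    rw [hwim, div_le_iff₀ (by positivity)]
    nlinarith [Real.pi_lt_d2, abs_nonneg y]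
  linarith

/-- **Upper bound**: `Re ψ(x + iy) ≤ 1.9 + ½ log(1 + y²)` for `3/4 ≤ x ≤ 5/4` and all real `y`
(for `|y| < 1` compare with `y = 1` by monotonicity). [folklore] -/
theorem re_digamma_upper {x : ℝ} (hx : 3 / 4 ≤ x) (hx' : x ≤ 5 / 4) (y : ℝ) :
    (digamma ((x : ℂ) + (y : ℂ) * I)).re ≤ 1.9 + 1 / 2 * Real.log (1 + y ^ 2) := by
  have hlog0 : 0 ≤ Real.log (1 + y ^ 2) := Real.log_nonneg (by nlinarith)
  rcases le_or_gt 1 |y| with hy | hy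
  · linarith [re_digamma_upper_of_one_le hx hx' hy]
  · have hmono : (digamma ((x : ℂ) + (y : ℂ) * I)).re ≤ (digamma ((x : ℂ) + ((1 : ℝ) : ℂ) * I)).re :=
      FordL32.re_digamma_mono (by linarith) (by rw [abs_one]; exact hy.le)
    have h1 := re_digamma_upper_of_one_le hx hx' (y := 1) (by simp)
    have e2 : Real.log (1 + (1 : ℝ) ^ 2) = Real.log 2 := by norm_num
    rw [e2] at h1
    have hl2 : Real.log 2 < 1 := by linarith [Real.log_two_lt_d9]
    have h1' : (digamma ((x : ℂ) + ((1 : ℝ) : ℂ) * I)).re ≤ 1.89 := by linarith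
    exact (hmono.trans h1').trans (by linarith)

/-- `|Re ψ(x + iy)| ≤ 1.9 + ½ log(1 + y²)` for `3/4 ≤ x ≤ 5/4`. [folklore] -/
theorem abs_re_digamma_le {x : ℝ} (hx : 3 / 4 ≤ x) (hx' : x ≤ 5 / 4) (y : ℝ) :
    |(digamma ((x : ℂ) + (y : ℂ) * I)).re| ≤ 1.9 + 1 / 2 * Real.log (1 + y ^ 2) := by
  have hlog0 : 0 ≤ Real.log (1 + y ^ 2) := Real.log_nonneg (by nlinarith)
  rw [abs_le]
  exact ⟨by linarith [re_digamma_lower hx y], re_digamma_upper hx hx' y⟩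

/-! ### The functional equation for `L'/L` at `s = −1/2 + iu` -/

variable {q : ℕ} [NeZero q] {χ : DirichletCharacter ℂ q}

omit [NeZero q] in
/-- `logDeriv` of a translate of `Γ_ℝ`: `(w ↦ Γ_ℝ(w + a))'/Γ_ℝ(· + a) = Γ_ℝ'/Γ_ℝ(w + a)`. [folklore] -/
theorem logDeriv_Gammaℝ_comp_add (a : ℂ) (w : ℂ) :
    logDeriv (fun z : ℂ ↦ Gammaℝ (z + a)) w = logDeriv Gammaℝ (w + a) := by
  rw [logDeriv_apply, logDeriv_apply, deriv_comp_add_const]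

/-- For a primitive character modulo `q ≥ 2` and real `u`: `L(−½ + iu, χ) ≠ 0`, and with `a` the
parity of `χ` and `z = ¾ + a/2 + iu/2`,
`L'/L(−½ + iu, χ) = −log q − L'/L(3/2 − iu, χ̄) + log π − Re ψ(z) + 1/(−½ + a + iu)`
— the source's `−L'/L(s, χ) = L'/L(1 − s, χ̄) + log(q/π) + Re ψ(¾ + a/2 + iu/2) + 1/(½ − a − iu)`,
(4.1). [cite: Khale2024, Lemma 4.2 (proof), (4.1)] -/
theorem logDeriv_LFunction_left_eq (hprim : χ.IsPrimitive) (hq : 2 ≤ q) (u : ℝ) :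
    ∃ a : ℝ, (a = 0 ∨ a = 1) ∧
      χ.LFunction (((-(1 / 2) : ℝ) : ℂ) + u * I) ≠ 0 ∧
      logDeriv χ.LFunction (((-(1 / 2) : ℝ) : ℂ) + u * I) =
        -(Real.log q : ℂ) - logDeriv χ⁻¹.LFunction (((3 / 2 : ℝ) : ℂ) + (-u) * I)
          + (Real.log π : ℂ)
          - ((digamma (((3 / 4 + a / 2 : ℝ) : ℂ) + ((u / 2 : ℝ) : ℂ) * I)).re : ℂ)
          + 1 / (((-(1 / 2) + a : ℝ) : ℂ) + u * I) := by
  obtain ⟨a, ha, hγ⟩ := exists_gammaFactor_eq χ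
  refine ⟨a, ha, ?_⟩
  have hχ : χ ≠ 1 := ne_one_of_isPrimitive hprim (by omega)
  set s : ℂ := ((-(1 / 2) : ℝ) : ℂ) + u * I with hs
  set s' : ℂ := ((3 / 2 : ℝ) : ℂ) + (-u) * I with hs'
  have hss' : s' = 1 - s := by
    rw [hs, hs']; apply Complex.ext
    · simp; norm_num
    · simp
  have hsre : s.re = -(1 / 2) := by simp [hs]
  have hs're : s'.re = 3 / 2 := by simp [hs']
  -- hypotheses of the reflection formula
  have hG : gammaFactor χ s ≠ 0 := by
    refine gammaFactor_ne_zero_of_not_int χ fun m hm ↦ ?_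
    rw [hsre] at hm
    have h2 : ((2 * m : ℤ) : ℝ) = -1 := by push_cast; linarith
    have h3 : (2 * m : ℤ) = -1 := by exact_mod_cast h2
    omega
  have hG1 : gammaFactor χ (1 - s) ≠ 0 :=
    SiegelZero.gammaFactor_ne_zero_of_re_pos χ (by rw [← hss', hs're]; norm_num)
  have hχ' : χ⁻¹ ≠ 1 := mt inv_eq_one.mp hχ
  have hL1 : χ⁻¹.LFunction (1 - s) ≠ 0 :=
    LFunction_ne_zero_of_one_le_re χ⁻¹ (Or.inl hχ') (by rw [← hss', hs're]; norm_num)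
  obtain ⟨hL, hrefl⟩ := logDeriv_LFunction_eq_reflect hprim hχ hG hG1 hL1
  refine ⟨hL, ?_⟩
  -- the Gamma factor as a translate of `Γ_ℝ`
  have hγf : gammaFactor χ = fun z : ℂ ↦ Gammaℝ (z + a) := funext hγ
  have hlog1 : logDeriv (gammaFactor χ) s = logDeriv Gammaℝ (s + a) := by
    rw [hγf, logDeriv_Gammaℝ_comp_add]
  have hlog2 : logDeriv (gammaFactor χ) (1 - s) = logDeriv Gammaℝ (s' + a) := by
    rw [hγf, logDeriv_Gammaℝ_comp_add, hss']
  -- `Γ_ℝ'/Γ_ℝ(s + a) = −½ log π + ½ ψ(z) − 1/(s + a)`, `z = (s+a)/2 + 1`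
  set z : ℂ := ((3 / 4 + a / 2 : ℝ) : ℂ) + ((u / 2 : ℝ) : ℂ) * I with hz
  have ha0 : 0 ≤ a := by rcases ha with rfl | rfl <;> norm_num
  have ha1 : a ≤ 1 := by rcases ha with rfl | rfl <;> norm_num
  have hw1re : (s + a).re = -(1 / 2) + a := by simp [hs]
  have hw10 : s + (a : ℂ) ≠ 0 := by
    intro h
    have := congrArg Complex.re h
    rw [hw1re] at this
    simp at this
    rcases ha with rfl | rfl <;> norm_num at this
  have ez : (s + a) / 2 + 1 = z := by rw [hs, hz]; push_cast; ring
  have hΓ1 : logDeriv Gammaℝ (s + a) = -(Complex.log π) / 2 + digamma z / 2 - 1 / (s + a) := by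
    rw [PsiOneExplicit.logDeriv_Gammaℝ_eq_shift (by rw [hw1re]; linarith) hw10, ez]
  -- `Γ_ℝ'/Γ_ℝ(s' + a) = −½ log π + ½ ψ(conj z)`, `(s' + a)/2 = conj z`
  have hconj : conj z = ((3 / 4 + a / 2 : ℝ) : ℂ) + ((-(u / 2) : ℝ) : ℂ) * I := by
    simp only [hz, map_add, map_mul, Complex.conj_ofReal, Complex.conj_I]
    push_cast; ring
  have ez' : (s' + a) / 2 = conj z := by rw [hconj, hs']; push_cast; ring
  have hpole : ∀ m : ℕ, (s' + a) / 2 ≠ -m := by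
    intro m h
    rw [ez', hconj] at h
    have := congrArg Complex.re h; simp at this
    have : (0 : ℝ) ≤ m := Nat.cast_nonneg m
    linarith
  have hΓ2 : logDeriv Gammaℝ (s' + a) = -(Complex.log π) / 2 + conj (digamma z) / 2 := by
    rw [Literature.NumberTheory.LFunctions.logDeriv_Gammaℝ hpole, ez', digamma_conj]
  -- assemble
  have hre : digamma z + conj (digamma z) = ((2 * (digamma z).re : ℝ) : ℂ) := Complex.add_conj _
  have hlogπ : Complex.log π = (Real.log π : ℂ) := (Complex.ofReal_log Real.pi_pos.le).symm
  have e3 : conj (digamma z) = 2 * ((digamma z).re : ℂ) - digamma z := by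
    rw [← sub_eq_iff_eq_add'.2 hre.symm]; push_cast; ring
  have hsa : s + (a : ℂ) = (((-(1 / 2) + a : ℝ) : ℂ) + u * I) := by rw [hs]; push_cast; ring
  rw [hrefl, hlog1, hlog2, hΓ1, hΓ2, hlogπ, e3, ← hss', hsa]
  ring

/-- **`L(−½ + iu, χ) ≠ 0`** for a primitive character modulo `q ≥ 2` (no trivial zero has real
part `−1/2`). [cite: Khale2024, Lemma 4.2 (proof)] -/
theorem LFunction_left_ne_zero (hprim : χ.IsPrimitive) (hq : 2 ≤ q) (u : ℝ) :
    χ.LFunction (((-(1 / 2) : ℝ) : ℂ) + u * I) ≠ 0 := by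
  obtain ⟨_, _, h, _⟩ := logDeriv_LFunction_left_eq hprim hq u
  exact h

/-! ### Lemma 4.2 -/

/-- `|log q − log π| ≤ log q − 1` for `q ≥ 3` ("the inequality `|log(q/π)| ≤ log q − 1`, which
holds for `q ≥ 3`"; from `1.09 < log π < 1.145`, `log 3 ≥ 1.09`). [cite: Khale2024, Lemma 4.2 (proof)] -/
theorem abs_log_sub_log_pi_le {q : ℕ} (hq : 3 ≤ q) :
    |Real.log q - Real.log π| ≤ Real.log q - 1 := by
  have hq' : (3 : ℝ) ≤ q := by exact_mod_cast hq
  have h3 : (1.09 : ℝ) ≤ Real.log q := VK.log_three_ge.trans (Real.log_le_log (by norm_num) hq')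
  have hπ1 := FordL32.log_pi_lt
  have hπ2 := FordL32.lt_log_pi
  rw [abs_le]; constructor <;> linarith

/-- **Khale 2024, Lemma 4.2, sharpened constant**: for a primitive character `χ` modulo `q ≥ 3`
and real `u`, `|L'/L(−½ + iu, χ)| ≤ log q + 4.9 + ½ log(1 + u²/4)`
(`|log(q/π)| + 2 + (1.9 + ½ log(1 + u²/4)) + 2 − 1`). [cite: Khale2024, Lemma 4.2] -/
theorem norm_logDeriv_LFunction_left_le_sharp (hprim : χ.IsPrimitive) (hq : 3 ≤ q) (u : ℝ) :
    ‖logDeriv χ.LFunction (((-(1 / 2) : ℝ) : ℂ) + u * I)‖ ≤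
      Real.log q + 4.9 + 1 / 2 * Real.log (1 + u ^ 2 / 4) := by
  obtain ⟨a, ha, -, heq⟩ := logDeriv_LFunction_left_eq hprim (le_trans (by norm_num) hq) u
  have ha0 : 0 ≤ a := by rcases ha with rfl | rfl <;> norm_num
  have ha1 : a ≤ 1 := by rcases ha with rfl | rfl <;> norm_num
  rw [heq]
  -- the four pieces
  set s' : ℂ := ((3 / 2 : ℝ) : ℂ) + (-u) * I with hs'
  have hs're : s'.re = 3 / 2 := by simp [hs']
  have hA : ‖-(Real.log q : ℂ) + (Real.log π : ℂ)‖ ≤ Real.log q - 1 := by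
    rw [show -(Real.log q : ℂ) + (Real.log π : ℂ) = ((-(Real.log q - Real.log π) : ℝ) : ℂ) by
      push_cast; ring, Complex.norm_real, Real.norm_eq_abs, abs_neg]
    exact abs_log_sub_log_pi_le hq
  have hB : ‖logDeriv χ⁻¹.LFunction s'‖ ≤ 2 := by
    have h := KhaleL41.norm_logDeriv_LFunction_lt χ⁻¹ (s := s') (by rw [hs're]; norm_num)
    rw [hs're, ← logDeriv_apply] at h
    norm_num at h
    exact h.le
  have hC : ‖((digamma (((3 / 4 + a / 2 : ℝ) : ℂ) + ((u / 2 : ℝ) : ℂ) * I)).re : ℂ)‖ ≤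
      1.9 + 1 / 2 * Real.log (1 + u ^ 2 / 4) := by
    rw [Complex.norm_real, Real.norm_eq_abs]
    have := abs_re_digamma_le (x := 3 / 4 + a / 2) (by linarith) (by linarith) (u / 2)
    rwa [show (u / 2) ^ 2 = u ^ 2 / 4 by ring] at this
  have hD : ‖1 / (((-(1 / 2) + a : ℝ) : ℂ) + u * I)‖ ≤ 2 := by
    set w : ℂ := (((-(1 / 2) + a : ℝ) : ℂ) + u * I) with hw
    have hwre : |w.re| = 1 / 2 := by
      rw [hw]; simp
      rcases ha with rfl | rfl <;> norm_num
    have hw0 : w ≠ 0 := fun h ↦ by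
      have := congrArg Complex.re h; simp [hw] at this
      rcases ha with rfl | rfl <;> norm_num at this
    have h1 : 1 / 2 ≤ ‖w‖ := hwre ▸ Complex.abs_re_le_norm w
    rw [norm_div, norm_one, div_le_iff₀ (norm_pos_iff.2 hw0)]
    linarith
  calc ‖-(Real.log q : ℂ) - logDeriv χ⁻¹.LFunction s' + (Real.log π : ℂ)
        - ((digamma (((3 / 4 + a / 2 : ℝ) : ℂ) + ((u / 2 : ℝ) : ℂ) * I)).re : ℂ)
        + 1 / (((-(1 / 2) + a : ℝ) : ℂ) + u * I)‖
      = ‖(-(Real.log q : ℂ) + (Real.log π : ℂ)) + (-logDeriv χ⁻¹.LFunction s')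
        + (-((digamma (((3 / 4 + a / 2 : ℝ) : ℂ) + ((u / 2 : ℝ) : ℂ) * I)).re : ℂ))
        + 1 / (((-(1 / 2) + a : ℝ) : ℂ) + u * I)‖ := by ring_nf
    _ ≤ ‖-(Real.log q : ℂ) + (Real.log π : ℂ)‖ + ‖-logDeriv χ⁻¹.LFunction s'‖
        + ‖-((digamma (((3 / 4 + a / 2 : ℝ) : ℂ) + ((u / 2 : ℝ) : ℂ) * I)).re : ℂ)‖
        + ‖1 / (((-(1 / 2) + a : ℝ) : ℂ) + u * I)‖ :=
          norm_add_le_of_le (norm_add₃_le) le_rfl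
    _ ≤ (Real.log q - 1) + 2 + (1.9 + 1 / 2 * Real.log (1 + u ^ 2 / 4)) + 2 := by
          rw [norm_neg, norm_neg]; gcongr
    _ = Real.log q + 4.9 + 1 / 2 * Real.log (1 + u ^ 2 / 4) := by ring

/-- **Khale 2024, Lemma 4.2** (as printed): for a primitive Dirichlet character `χ` modulo `q ≥ 3`
and real `u`, `|L'/L(−½ + iu, χ)| ≤ 8.21 + log q + ½ log(1 + u²/4)`. [cite: Khale2024, Lemma 4.2] -/
theorem norm_logDeriv_LFunction_left_le (hprim : χ.IsPrimitive) (hq : 3 ≤ q) (u : ℝ) :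
    ‖logDeriv χ.LFunction (((-(1 / 2) : ℝ) : ℂ) + u * I)‖ ≤
      8.21 + Real.log q + 1 / 2 * Real.log (1 + u ^ 2 / 4) := by
  have := norm_logDeriv_LFunction_left_le_sharp hprim hq u
  linarith

/-- Lemma 4.2 in `deriv/value` form: `‖L'(−½ + iu, χ)/L(−½ + iu, χ)‖ ≤ 8.21 + log q + ½ log(1 + u²/4)`.
[cite: Khale2024, Lemma 4.2] -/
theorem norm_deriv_div_LFunction_left_le (hprim : χ.IsPrimitive) (hq : 3 ≤ q) (u : ℝ) :
    ‖deriv χ.LFunction (((-(1 / 2) : ℝ) : ℂ) + u * I) / χ.LFunction (((-(1 / 2) : ℝ) : ℂ) + u * I)‖ ≤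
      8.21 + Real.log q + 1 / 2 * Real.log (1 + u ^ 2 / 4) := by
  rw [← logDeriv_apply]
  exact norm_logDeriv_LFunction_left_le hprim hq u

end KhaleL42

end Literature.NumberTheory.LFunctions
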